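import Mathlib.Algebra.BigOperators.Ring.Finset
import Literature.Computability.QuantumComplexity.ShallowCircuits
import HarnessLib

/-!
# The quadratic form of a 2D HLF instance: polarisation and the kernel criterion

Trunk `CryptoQuantFine` / family `quantum-advantage`. Elementary algebra of the `ℤ₄`-valued
quadratic form `q(x) = 2 Σ_{α<β} A_{αβ} x_α x_β + Σ_α b_α x_α` of a *valid* 2D Hidden Linear
Function instance (`HLFInstance.q`, Bravyi–Gosset–König, *Quantum advantage with shallow
circuits*, Science 362 (2018), arXiv:1704.00690, Eq. (1)):

* `HLFInstance.q_eq_symm`: the order-free form `q(x) = Σ_{u,v} A_{uv} x_u x_v + Σ_v b_v x_v`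
  (ordered pairs; uses symmetry of `A` and the vanishing diagonal);
* `HLFInstance.q_add` (polarisation): `q(x ⊕ y) = q(x) + q(y) + 2 Σ_v y_v ((A + diag b) x)_v`, where
  `HLFInstance.kerCount I x v = #{u : A_{uv} = 1, x_u = 1} + b_v x_v` is the `v`-th coordinate of
  `(A + diag b) x` computed over `ℕ`;
* `HLFInstance.mem_Lq_iff` / `mem_Lq_of_even` (kernel criterion): `x ∈ L_q` iff all
  `kerCount I x v` are even, i.e. `L_q` is the binary kernel of `A + diag b`;
* `HLFInstance.solution_identity`: for such `x` and any solution `z`, `q(x) = 2 |z ∧ x| (mod 4)`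
  in the order-free form.

Only the definitions of `q`, `L_q` and of a solution (BGK Eq. (1)–(2) of the Science text, which
are Eq. (5)–(7), Lemma 1 and the problem statement of §3 in arXiv:1704.00690v1) come from the
source; the polarisation identity and the kernel description of `L_q` are elementary consequences
that BGK do not print, recorded here (tagged folklore) for the forthcoming files on the classical
lower bound (BGK Theorem 2), which use no quantum states.

## References

* S. Bravyi, D. Gosset, R. König, *Quantum advantage with shallow circuits*, Science 362 (2018)
  308–311, Eq. (1)–(2); arXiv:1704.00690v1, §3, Eq. (5)–(7) and Lemma 1.
-/

namespace Literature.Computability.QuantumComplexity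

/-! ### Two facts about `ℤ₄` -/

/-- Twice an even number vanishes modulo `4`. [folklore] -/
theorem two_mul_natCast_eq_zero_of_even {n : ℕ} (h : Even n) : (2 : ZMod 4) * (n : ZMod 4) = 0 := by
  obtain ⟨k, rfl⟩ := h
  rw [← two_mul, Nat.cast_mul, ← mul_assoc]
  simp only [Nat.cast_ofNat]
  rw [show (2 : ZMod 4) * 2 = 0 by decide, zero_mul]

/-- Modulo `4`, twice a natural number vanishes only if the number is even. [folklore] -/
theorem even_of_two_mul_natCast_eq_zero {n : ℕ} (h : (2 : ZMod 4) * (n : ZMod 4) = 0) : Even n := by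
  have h4 : 4 ∣ 2 * n := by
    rw [← ZMod.natCast_eq_zero_iff]
    exact_mod_cast h
  obtain ⟨k, hk⟩ := h4
  exact ⟨k, by omega⟩

open Finset

namespace HLFInstance

variable {N : ℕ}

/-- Pointwise symmetrisation: the indicators of `u < v ∧ p` and `v < u ∧ p` add up to the
indicator of `p` when `p` excludes `u = v`. [folklore] -/
private theorem ite_lt_add_ite_gt {α : Type*} [AddCommMonoidWithOne α] (u v : Fin N × Fin N)
    (p : Prop) [Decidable p] (hp : u = v → ¬p) :
    ((if finProdFinEquiv u < finProdFinEquiv v ∧ p then (1 : α) else 0) +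
        if finProdFinEquiv v < finProdFinEquiv u ∧ p then (1 : α) else 0) =
      if p then 1 else 0 := by
  by_cases h : p
  · rcases lt_trichotomy (finProdFinEquiv u) (finProdFinEquiv v) with hlt | heq | hgt
    · simp [h, hlt, not_lt_of_gt hlt]
    · exact absurd h (hp (finProdFinEquiv.injective heq))
    · simp [h, hgt, not_lt_of_gt hgt]
  · simp [h]

/-- The order-free form of the quadratic form of a *valid* instance:
`q(x) = Σ_{u,v} A_{uv} x_u x_v + Σ_v b_v x_v (mod 4)`, the double sum running over ordered
pairs (each edge counted twice, which absorbs the factor `2` of Eq. (1); the diagonal of `A`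
vanishes). (An elementary rewriting of Bravyi–Gosset–König 2018, Eq. (1); arXiv Eq. (5)/(14).) [cite: BravyiGossetKonigScience2018, Eq. (1)] -/
theorem q_eq_symm (I : HLFInstance N) (hI : I.IsValid) (x : Fin N × Fin N → Bool) :
    I.q x = (∑ u, ∑ v, if I.A u v = true ∧ x u = true ∧ x v = true then (1 : ZMod 4) else 0) +
      ∑ v, if I.b v = true ∧ x v = true then (1 : ZMod 4) else 0 := by
  unfold q
  congr 1
  rw [two_mul]
  conv_lhs => arg 2; rw [Finset.sum_comm]
  rw [← Finset.sum_add_distrib]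
  refine Finset.sum_congr rfl fun u _ => ?_
  rw [← Finset.sum_add_distrib]
  refine Finset.sum_congr rfl fun v _ => ?_
  have hsym : (I.A v u = true ∧ x v = true ∧ x u = true) ↔ (I.A u v = true ∧ x u = true ∧ x v = true) := by
    rw [hI.1 v u]; tauto
  rw [show (if finProdFinEquiv v < finProdFinEquiv u ∧ I.A v u = true ∧ x v = true ∧ x u = true
        then (1 : ZMod 4) else 0) =
      if finProdFinEquiv v < finProdFinEquiv u ∧ (I.A u v = true ∧ x u = true ∧ x v = true)
        then (1 : ZMod 4) else 0 by simp only [hsym]]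
  apply ite_lt_add_ite_gt
  rintro rfl ⟨hA, -, -⟩
  exact (hI.2 u u hA).ne rfl

/-- The `v`-th coordinate of `(A + diag b) x` over the integers: the number of `A`-neighbours
`u` of `v` with `x_u = 1`, plus `b_v x_v`. The subspace `L_q` is the set of `x` for which all
these numbers are even (`mem_Lq_iff`; an elementary description not stated in BGK). [folklore] -/
def kerCount (I : HLFInstance N) (x : Fin N × Fin N → Bool) (v : Fin N × Fin N) : ℕ :=
  (univ.filter fun u => I.A u v = true ∧ x u = true).card +
    if I.b v = true ∧ x v = true then 1 else 0

/-- Truth-table identity behind the polarisation of the quadratic part (`2·` a Boolean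
product of XORs, modulo `4`). [folklore] -/
private theorem pt_quad (p : Prop) [Decidable p] (a xu xv yu yv : Bool) :
    (2 : ZMod 4) * (if p ∧ a = true ∧ (xor xu yu) = true ∧ (xor xv yv) = true then 1 else 0) =
      2 * (if p ∧ a = true ∧ xu = true ∧ xv = true then 1 else 0) +
      2 * (if p ∧ a = true ∧ yu = true ∧ yv = true then 1 else 0) +
      (2 * (if p ∧ a = true ∧ xu = true ∧ yv = true then 1 else 0) +
       2 * (if p ∧ a = true ∧ yu = true ∧ xv = true then 1 else 0)) := by
  by_cases hp : p <;> cases a <;> cases xu <;> cases xv <;> cases yu <;> cases yv <;>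
    (simp [hp]; try decide)

/-- Truth-table identity behind the polarisation of the linear part modulo `4`. [folklore] -/
private theorem pt_lin (b xv yv : Bool) :
    (if b = true ∧ (xor xv yv) = true then (1 : ZMod 4) else 0) =
      (if b = true ∧ xv = true then 1 else 0) + (if b = true ∧ yv = true then 1 else 0) +
        2 * (if yv = true then 1 else 0) * (if b = true ∧ xv = true then 1 else 0) := by
  cases b <;> cases xv <;> cases yv <;> (simp; try decide)

/-- **Polarisation of `q`.** For a valid instance and all `x, y`,
`q(x ⊕ y) = q(x) + q(y) + 2 Σ_v y_v · ((A + diag b) x)_v (mod 4)`. (Elementary consequence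
of the definition of `q`, BGK Eq. (1); not stated in BGK.) [folklore] -/
theorem q_add (I : HLFInstance N) (hI : I.IsValid) (x y : Fin N × Fin N → Bool) :
    I.q (x + y) = I.q x + I.q y +
      2 * ∑ v, (if y v = true then (1 : ZMod 4) else 0) * (I.kerCount x v : ZMod 4) := by
  have hxy : ∀ u, (x + y) u = xor (x u) (y u) := fun u => rfl
  -- the cross term, symmetrised
  have hcross :
      ((∑ u, ∑ v, (2 : ZMod 4) * (if finProdFinEquiv u < finProdFinEquiv v ∧ I.A u v = true ∧
            x u = true ∧ y v = true then 1 else 0)) +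
        ∑ u, ∑ v, (2 : ZMod 4) * (if finProdFinEquiv u < finProdFinEquiv v ∧ I.A u v = true ∧
            y u = true ∧ x v = true then 1 else 0)) =
        ∑ v, ∑ u, 2 * ((if y v = true then (1 : ZMod 4) else 0) *
          (if I.A u v = true ∧ x u = true then 1 else 0)) := by
    conv_lhs => arg 1; rw [Finset.sum_comm]
    rw [← Finset.sum_add_distrib]
    refine Finset.sum_congr rfl fun v _ => ?_
    rw [← Finset.sum_add_distrib]
    refine Finset.sum_congr rfl fun u _ => ?_
    rw [← mul_add]
    have hsym : (I.A v u = true ∧ y v = true ∧ x u = true) ↔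
        (I.A u v = true ∧ x u = true ∧ y v = true) := by rw [hI.1 v u]; tauto
    rw [show (if finProdFinEquiv v < finProdFinEquiv u ∧ I.A v u = true ∧ y v = true ∧ x u = true
          then (1 : ZMod 4) else 0) =
        if finProdFinEquiv v < finProdFinEquiv u ∧ (I.A u v = true ∧ x u = true ∧ y v = true)
          then (1 : ZMod 4) else 0 by simp only [hsym]]
    rw [ite_lt_add_ite_gt u v _ (by rintro rfl ⟨hA, -, -⟩; exact (hI.2 u u hA).ne rfl)]
    by_cases hy : y v = true <;> by_cases hA : I.A u v = true ∧ x u = true <;> simp [hy, hA]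
  -- main computation
  unfold q
  simp only [hxy]
  simp_rw [Finset.mul_sum, pt_quad, pt_lin, Finset.sum_add_distrib]
  rw [hcross]
  simp only [kerCount, Nat.cast_add, Nat.cast_ite, Nat.cast_one, Nat.cast_zero,
    natCast_card_filter]
  simp only [mul_add, Finset.sum_add_distrib, Finset.mul_sum, mul_assoc]
  abel

/-- **Kernel criterion for `L_q`** (sufficiency). If every coordinate of `(A + diag b) x` is even, then
`x ∈ L_q`, i.e. `q(x ⊕ y) = q(x) + q(y)` for all `y` (`L_q` as defined in BGK Eq. (2) of the
Science text, arXiv Eq. (7); the criterion itself is the standard description of this subspace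
of a `ℤ₄`-valued quadratic form and is not stated in BGK). [folklore] -/
theorem mem_Lq_of_even (I : HLFInstance N) (hI : I.IsValid) (x : Fin N × Fin N → Bool)
    (h : ∀ v, Even (I.kerCount x v)) : x ∈ I.Lq := by
  intro y
  rw [I.q_add hI x y, Finset.mul_sum]
  rw [Finset.sum_eq_zero fun v _ => ?_, add_zero]
  rw [mul_left_comm, two_mul_natCast_eq_zero_of_even (h v), mul_zero]

/-- **Kernel criterion for `L_q`.** For a valid instance, `x ∈ L_q` iff every coordinate of
`(A + diag b) x` is even: `L_q` is the binary kernel of `A + diag b`. (The converse direction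
tests `q(x ⊕ e_v) = q(x) + q(e_v)` on the unit vectors `e_v`; not stated in BGK.) [folklore] -/
theorem mem_Lq_iff (I : HLFInstance N) (hI : I.IsValid) (x : Fin N × Fin N → Bool) :
    x ∈ I.Lq ↔ ∀ v, Even (I.kerCount x v) := by
  refine ⟨fun hx v => ?_, I.mem_Lq_of_even hI x⟩
  have h := hx (fun u => decide (u = v))
  rw [I.q_add hI, add_eq_left] at h
  rw [Finset.sum_eq_single v (fun u _ hu => by simp [hu]) (by simp)] at h
  simp only [decide_eq_true_eq, if_true, one_mul] at h
  exact even_of_two_mul_natCast_eq_zero h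

/-- For a solution `z` and a vector `x` in the kernel of `A + diag b`, the defining identity
`q(x) = 2 zᵀx` in the order-free form: `Σ_{u,v} A_{uv}x_ux_v + Σ_v b_v x_v = 2 |{v : z_v = x_v = 1}|
(mod 4)`. (Bravyi–Gosset–König 2018, Eq. (2): the defining property of a solution, here
combined with `q_eq_symm` and `mem_Lq_of_even`.) [cite: BravyiGossetKonigScience2018, Eq. (2)] -/
theorem solution_identity (I : HLFInstance N) (hI : I.IsValid) {z x : Fin N × Fin N → Bool}
    (hz : z ∈ hlfSolutions I) (hx : ∀ v, Even (I.kerCount x v)) :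
    ((∑ u, ∑ v, if I.A u v = true ∧ x u = true ∧ x v = true then (1 : ZMod 4) else 0) +
        ∑ v, if I.b v = true ∧ x v = true then (1 : ZMod 4) else 0) =
      2 * ((univ.filter fun v => z v = true ∧ x v = true).card : ZMod 4) := by
  rw [← I.q_eq_symm hI x, hz x (I.mem_Lq_of_even hI x hx), natCast_card_filter]

end HLFInstance

end Literature.Computability.QuantumComplexity
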